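import Summits.CriticalPhenomena.Ising3DConformalLimit.Theorems.FKParityRobustnessDefs
import Literature.Probability.LatticeModels.LoopO1
import Mathlib.Combinatorics.SimpleGraph.Trails
import Mathlib.Algebra.BigOperators.Group.Finset.Sigma
import HarnessLib

/-!
# The plaquette-XOR mass-transport identity: stub `stub_xorTransport` of line
# `plaquette-xor-surgery` for crux `ParityRobustMerging` (stmt-CriticalPhenomena-11253)

Route `FKParityRobustness`.  For a finite graph `G`, a real edge weight `t` and four marked vertices
`a : Fin 4 → V`, with `𝒯_A = tJoins G univ {aᵢ}` the `T`-joins of `A = {aᵢ}` (edge sets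
`F ⊆ E(G)` with odd degree exactly at the `aᵢ`), `C = JoinsAll a` and `H = ¬ C`
(vocabulary file `Theorems/FKParityRobustnessDefs.lean`):

  `ntMass G t a = ∑_{F ∈ 𝒯_A, H} t^{|F|+4} · #nearTouch(F)`
  `             = ∑_{F' ∈ 𝒯_A, C} t^{|F'|} · #pivotals(F') = pivMass G t a`.

Pure double counting, every real `t`: both sides are sums over pairs, and
`(F, P) ↦ (F ⊔ P, P)` is a bijection from the pairs `(F, P)` with `F ∈ 𝒯_A`, `¬ JoinsAll a F`,
`P ∈ nearTouch G a F` (a plaquette edge-disjoint from `F` with `JoinsAll a (F ∪ P)`) onto the pairs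
`(F', P)` with `F' ∈ 𝒯_A`, `JoinsAll a F'`, `P ∈ pivotals G a F'` (`P ⊆ F'`,
`¬ JoinsAll a (F' \ P)`), with inverse `(F', P) ↦ (F' \ P, P)`; the weights match because a
plaquette has exactly four edges and even degree at every vertex, so that `F ⊔ P ∈ 𝒯_A` and
`|F ⊔ P| = |F| + 4`.

* `IsPlaquette.card_eq_four_and_even` — a plaquette `P` (edge set of a 4-cycle `w ∼ x ∼ y ∼ z ∼ w`,
  `w ≠ y`, `x ≠ z`) has `#P = 4` and even `P`-degree everywhere (it is the edge set of a closed
  trail; `SimpleGraph.Walk.IsTrail.even_countP_edges_iff`);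
* `mem_plaquettes` — unfolding of `plaquettes`;
* `union_mem_tJoins_iff` — for `P ⊆ E(G)` even and edge-disjoint from `F`:
  `F ∪ P ∈ 𝒯_A ↔ F ∈ 𝒯_A`;
* `ntMass_eq_pivMass` — the identity (`Finset.sum_sigma'` + `Finset.sum_nbij'`);
* `stub_xorTransport` — the registered stub, verbatim.

Theorem-only file (no new definitions); Mathlib + the tree's `LoopO1` + the line's vocabulary file.
References: the line card `Cruxes/ParityRobustMerging/Lines/plaquette-xor-surgery.md`;
G. Grimmett, S. Janson, *Random even graphs*, arXiv:0709.3039 (the cycle-space coset structure of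
`T`-joins).
-/

noncomputable section

open Finset
open Literature.Probability.LatticeModels

namespace Summit.CriticalPhenomena.Ising3DConformalLimit.Cruxes.ParityRobustMerging.PlaquetteXorSurgery

open scoped Classical

section General

variable {V : Type*} [Fintype V] [DecidableEq V] {G : SimpleGraph V} [DecidableRel G.Adj]

omit [Fintype V] [DecidableRel G.Adj] in
/-- A plaquette — the edge set `{s(w,x), s(x,y), s(y,z), s(z,w)}` of a 4-cycle of `G` with `w ≠ y`,
`x ≠ z` — has exactly four edges, and every vertex has even degree in it (it is the edge set of the
closed trail `w → x → y → z → w`). -/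
theorem IsPlaquette.card_eq_four_and_even {P : Finset (Sym2 V)} (hP : IsPlaquette G P) :
    #P = 4 ∧ ∀ v : V, Even #(P.filter (v ∈ ·)) := by
  obtain ⟨w, x, y, z, hwy, hxz, hwx, hxy, hyz, hzw, rfl⟩ := hP
  obtain ⟨c, hce⟩ : ∃ c : G.Walk w w, c.edges = [s(w, x), s(x, y), s(y, z), s(z, w)] :=
    ⟨.cons hwx (.cons hxy (.cons hyz (.cons hzw .nil))), by simp⟩
  have hnd : c.edges.Nodup := by
    rw [hce]
    simp [hwx.ne, hwx.ne.symm, hxy.ne, hyz.ne, hzw.ne, hzw.ne.symm, hwy, hwy.symm, hxz]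
  have hPc : ({s(w, x), s(x, y), s(y, z), s(z, w)} : Finset (Sym2 V)) = c.edges.toFinset := by
    rw [hce]
    simp
  refine ⟨?_, fun v => ?_⟩
  · rw [hPc, List.toFinset_card_of_nodup hnd, hce]
    rfl
  · rw [hPc]
    have hcount : #(c.edges.toFinset.filter (v ∈ ·)) = c.edges.countP (fun e => v ∈ e) := by
      rw [List.countP_eq_length_filter, ← List.toFinset_card_of_nodup (hnd.filter _),
        List.toFinset_filter]
      congr 1
      ext e
      simp
    rw [hcount]
    exact (SimpleGraph.Walk.IsTrail.even_countP_edges_iff ⟨hnd⟩ v).2 fun h => absurd rfl h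

variable (G) in
/-- Membership in `plaquettes G`: `P` is made of edges of `G` and is a plaquette. -/
theorem mem_plaquettes {P : Finset (Sym2 V)} :
    P ∈ plaquettes G ↔ P ⊆ G.edgeFinset ∧ IsPlaquette G P := by
  rw [plaquettes, Finset.mem_filter, Finset.mem_powerset]

variable (G) in
/-- **XOR with an even, edge-disjoint set of edges of `G` preserves `𝒯_A`**: if `P ⊆ E(G)` has even
degree at every vertex and is disjoint from `F`, then `F ∪ P` is a `T`-join of `A` iff `F` is
(the `T`-joins form a coset of the cycle space; here only the disjoint case is needed, where
`F ∆ P = F ∪ P`). -/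
theorem union_mem_tJoins_iff {A : Finset V} {F P : Finset (Sym2 V)} (hPG : P ⊆ G.edgeFinset)
    (hPeven : ∀ v : V, Even #(P.filter (v ∈ ·))) (hdisj : Disjoint F P) :
    F ∪ P ∈ tJoins G Set.univ A ↔ F ∈ tJoins G Set.univ A := by
  rw [mem_tJoins, mem_tJoins, Finset.union_subset_iff]
  simp only [Set.subset_univ, true_and, hPG, and_true]
  refine and_congr_right fun _ => forall_congr' fun v => ?_
  rw [Finset.filter_union, Finset.card_union_of_disjoint (Finset.disjoint_filter_filter hdisj),
    Nat.odd_add, iff_true_right (hPeven v)]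

variable (G) in
/-- **The plaquette-XOR mass-transport identity** `ntMass G t a = pivMass G t a` on every finite
graph, for every real `t`: `∑_{F ∈ 𝒯_A, ¬C} t^{|F|+4}·#nearTouch(F) = ∑_{F' ∈ 𝒯_A, C} t^{|F'|}·#pivotals(F')`.
Both sides are sums over pairs; `(F, P) ↦ (F ∪ P, P)` and `(F', P) ↦ (F' \ P, P)` are inverse
bijections between the index sets, and `t^{|F|+4} = t^{|F ∪ P|}` since `#P = 4` and `P ∩ F = ∅`. -/
theorem ntMass_eq_pivMass (t : ℝ) (a : Fin 4 → V) : ntMass G t a = pivMass G t a := by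
  unfold ntMass pivMass
  calc ∑ F ∈ (tJoins G Set.univ (univ.image a)).filter (fun F => ¬ JoinsAll a F),
          t ^ (#F + 4) * (#(nearTouch G a F) : ℝ)
      = ∑ F ∈ (tJoins G Set.univ (univ.image a)).filter (fun F => ¬ JoinsAll a F),
          ∑ P ∈ nearTouch G a F, t ^ (#F + 4) :=
        Finset.sum_congr rfl fun F _ => by rw [Finset.sum_const, nsmul_eq_mul, mul_comm]
    _ = ∑ x ∈ ((tJoins G Set.univ (univ.image a)).filter (fun F => ¬ JoinsAll a F)).sigma
          (fun F => nearTouch G a F), t ^ (#x.1 + 4) :=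
        Finset.sum_sigma' _ _ _
    _ = ∑ x ∈ ((tJoins G Set.univ (univ.image a)).filter (fun F => JoinsAll a F)).sigma
          (fun F => pivotals G a F), t ^ #x.1 := by
        refine Finset.sum_nbij' (fun x => ⟨x.1 ∪ x.2, x.2⟩) (fun x => ⟨x.1 \ x.2, x.2⟩)
          ?_ ?_ ?_ ?_ ?_
        · rintro ⟨F, P⟩ hx
          simp only [Finset.mem_sigma, Finset.mem_filter, nearTouch, pivotals] at hx ⊢
          obtain ⟨⟨hFT, hH⟩, hPpl, hdisj, hJ⟩ := hx
          obtain ⟨hPG, hP⟩ := (mem_plaquettes G).1 hPpl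
          refine ⟨⟨(union_mem_tJoins_iff G hPG hP.card_eq_four_and_even.2 hdisj.symm).2 hFT, hJ⟩,
            hPpl, Finset.subset_union_right, ?_⟩
          rw [Finset.union_sdiff_cancel_right hdisj.symm]
          exact hH
        · rintro ⟨F, P⟩ hx
          simp only [Finset.mem_sigma, Finset.mem_filter, nearTouch, pivotals] at hx ⊢
          obtain ⟨⟨hFT, hC⟩, hPpl, hsub, hnJ⟩ := hx
          obtain ⟨hPG, hP⟩ := (mem_plaquettes G).1 hPpl
          refine ⟨⟨?_, hnJ⟩, hPpl, Finset.disjoint_sdiff, ?_⟩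
          · rw [← union_mem_tJoins_iff G hPG hP.card_eq_four_and_even.2 Finset.sdiff_disjoint,
              Finset.sdiff_union_of_subset hsub]
            exact hFT
          · rw [Finset.sdiff_union_of_subset hsub]
            exact hC
        · rintro ⟨F, P⟩ hx
          simp only [Finset.mem_sigma, Finset.mem_filter, nearTouch] at hx
          obtain ⟨-, -, hdisj, -⟩ := hx
          dsimp only
          rw [Finset.union_sdiff_cancel_right hdisj.symm]
        · rintro ⟨F, P⟩ hx
          simp only [Finset.mem_sigma, Finset.mem_filter, pivotals] at hx
          obtain ⟨-, -, hsub, -⟩ := hx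
          dsimp only
          rw [Finset.sdiff_union_of_subset hsub]
        · rintro ⟨F, P⟩ hx
          simp only [Finset.mem_sigma, Finset.mem_filter, nearTouch] at hx
          obtain ⟨-, hPpl, hdisj, -⟩ := hx
          obtain ⟨-, hP⟩ := (mem_plaquettes G).1 hPpl
          dsimp only
          rw [Finset.card_union_of_disjoint hdisj.symm, hP.card_eq_four_and_even.1]
    _ = ∑ F ∈ (tJoins G Set.univ (univ.image a)).filter (fun F => JoinsAll a F),
          ∑ P ∈ pivotals G a F, t ^ #F :=
        Finset.sum_sigma _ _ _
    _ = ∑ F ∈ (tJoins G Set.univ (univ.image a)).filter (fun F => JoinsAll a F),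
          t ^ #F * (#(pivotals G a F) : ℝ) :=
        Finset.sum_congr rfl fun F _ => by rw [Finset.sum_const, nsmul_eq_mul, mul_comm]

end General

/-- STUB `stub_xorTransport` of the skeleton `Lines/plaquette-xor-surgery.lean` (crux
`ParityRobustMerging`, stmt-CriticalPhenomena-11253), verbatim: the plaquette-XOR MASS-TRANSPORT
IDENTITY `ntMass G t a = pivMass G t a` on every finite graph and for every real `t`
(`ntMass_eq_pivMass` in closed form). -/
theorem stub_xorTransport :
    ∀ (V : Type) [Fintype V] [DecidableEq V] (G : SimpleGraph V) [DecidableRel G.Adj]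
      (t : ℝ) (a : Fin 4 → V), ntMass G t a = pivMass G t a :=
  fun _ _ _ G _ t a => ntMass_eq_pivMass G t a

end Summit.CriticalPhenomena.Ising3DConformalLimit.Cruxes.ParityRobustMerging.PlaquetteXorSurgery

end
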